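import Summits.CriticalPhenomena.Ising3DConformalLimit.Theorems.SynchronousCouplingRotationJoiningL2Limit

/-!
# Route `SynchronousCoupling`, crux `RotationJoining` (stmt-CriticalPhenomena-18763), line `SketchIdeator2`:
`L²` tools for the splitting transfer `stub_qualitativeOfFDDIsotropy`

Pure measure theory, no lattice input:
* `sqrt_integral_sq_sub_le_of_integrable` / `…_of_memLp` — Minkowski in `L²` (`√∫(a−c)² ≤ √∫(a−b)² + √∫(b−c)²`)
  under integrability resp. `MemLp 2` hypotheses (the landed `sqrt_integral_sq_sub_le` asks for boundedness);
* `integral_abs_le_sqrt_integral_sq` — `∫ |g| ≤ √∫ g²` on a probability space (variance is nonnegative);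
* `tendsto_integral_lipschitz_of_l2` — if every coordinate of `V k : Ω → ℝᵈ` converges in `L²(P)` to the
  corresponding coordinate of `V∞`, then `∫ f (V k) dP → ∫ f (V∞) dP` for every bounded `1`-Lipschitz `f : ℝᵈ → ℝ`
  (`|∫ f(V k) − ∫ f(V∞)| ≤ Σᵢ ‖V k i − V∞ i‖_{L¹} ≤ Σᵢ ‖·‖_{L²}`), registered specialisation `stub_lipschitzTestConvergence`
  on the chain space `ℕ → SpinConfig (Site 3)`;
* `map_eval_of_map_pair` — the coordinate law of a path measure from its pair law.
-/

noncomputable section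

namespace Summit.CriticalPhenomena.Ising3DConformalLimit.Cruxes.RotationJoining.RateSplitting

open MeasureTheory ProbabilityTheory Filter Topology

section General

variable {Ω : Type*} [MeasurableSpace Ω]

/-- **Minkowski in `L²`** in the form `√∫(a−c)² ≤ √∫(a−b)² + √∫(b−c)²`, under integrability of the three squares. -/
theorem sqrt_integral_sq_sub_le_of_integrable (μ : Measure Ω) {a b c : Ω → ℝ}
    (hIab : Integrable (fun x => (a x - b x) ^ 2) μ) (hIbc : Integrable (fun x => (b x - c x) ^ 2) μ)
    (hIac : Integrable (fun x => (a x - c x) ^ 2) μ) :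
    Real.sqrt (∫ x, (a x - c x) ^ 2 ∂μ) ≤
      Real.sqrt (∫ x, (a x - b x) ^ 2 ∂μ) + Real.sqrt (∫ x, (b x - c x) ^ 2 ∂μ) := by
  set X := ∫ x, (a x - b x) ^ 2 ∂μ with hX
  set Y := ∫ x, (b x - c x) ^ 2 ∂μ with hY
  set Z := ∫ x, (a x - c x) ^ 2 ∂μ with hZ
  have hX0 : 0 ≤ X := integral_nonneg fun x => sq_nonneg _
  have hY0 : 0 ≤ Y := integral_nonneg fun x => sq_nonneg _
  -- for every `t > 0`, `Z ≤ (1+t) X + (1+t⁻¹) Y`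
  have hZt : ∀ t : ℝ, 0 < t → Z ≤ (1 + t) * X + (1 + t⁻¹) * Y := by
    intro t ht
    have hle : ∀ x, (a x - c x) ^ 2 ≤ (1 + t) * (a x - b x) ^ 2 + (1 + t⁻¹) * (b x - c x) ^ 2 := by
      intro x
      have := add_sq_le_weighted ht (a x - b x) (b x - c x)
      rwa [show a x - b x + (b x - c x) = a x - c x by ring] at this
    calc Z ≤ ∫ x, ((1 + t) * (a x - b x) ^ 2 + (1 + t⁻¹) * (b x - c x) ^ 2) ∂μ :=
          integral_mono hIac ((hIab.const_mul _).add (hIbc.const_mul _)) hle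
      _ = (1 + t) * X + (1 + t⁻¹) * Y := by
          rw [integral_add (hIab.const_mul _) (hIbc.const_mul _), integral_const_mul, integral_const_mul]
  set A := Real.sqrt X with hA
  set B := Real.sqrt Y with hB
  have hA0 : 0 ≤ A := Real.sqrt_nonneg _
  have hB0 : 0 ≤ B := Real.sqrt_nonneg _
  have hXA : X = A ^ 2 := (Real.sq_sqrt hX0).symm
  have hYB : Y = B ^ 2 := (Real.sq_sqrt hY0).symm
  refine le_of_forall_pos_le_add fun ε hε => ?_
  set A' := A + ε / 2 with hA'
  set B' := B + ε / 2 with hB'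
  have hA'0 : 0 < A' := by positivity
  have hB'0 : 0 < B' := by positivity
  have hZle : Z ≤ (A' + B') ^ 2 := by
    have h := hZt (B' / A') (div_pos hB'0 hA'0)
    have hXle : X ≤ A' ^ 2 := by rw [hXA]; gcongr; linarith
    have hYle : Y ≤ B' ^ 2 := by rw [hYB]; gcongr; linarith
    have h1 : 0 ≤ 1 + B' / A' := by positivity
    have h2 : 0 ≤ 1 + (B' / A')⁻¹ := by positivity
    calc Z ≤ (1 + B' / A') * X + (1 + (B' / A')⁻¹) * Y := h
      _ ≤ (1 + B' / A') * A' ^ 2 + (1 + (B' / A')⁻¹) * B' ^ 2 := by gcongr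
      _ = (A' + B') ^ 2 := by
          field_simp
          ring
  calc Real.sqrt Z ≤ Real.sqrt ((A' + B') ^ 2) := Real.sqrt_le_sqrt hZle
    _ = A' + B' := Real.sqrt_sq (by positivity)
    _ = A + B + ε := by rw [hA', hB']; ring

/-- **Minkowski in `L²`**, `MemLp 2` version. -/
theorem sqrt_integral_sq_sub_le_of_memLp (μ : Measure Ω) {a b c : Ω → ℝ}
    (ha : MemLp a 2 μ) (hb : MemLp b 2 μ) (hc : MemLp c 2 μ) :
    Real.sqrt (∫ x, (a x - c x) ^ 2 ∂μ) ≤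
      Real.sqrt (∫ x, (a x - b x) ^ 2 ∂μ) + Real.sqrt (∫ x, (b x - c x) ^ 2 ∂μ) :=
  sqrt_integral_sq_sub_le_of_integrable μ (ha.sub hb).integrable_sq (hb.sub hc).integrable_sq
    (ha.sub hc).integrable_sq

/-- On a probability space, `∫ |g| ≤ √(∫ g²)` for `g ∈ L²` (the variance of `|g|` is nonnegative). -/
theorem integral_abs_le_sqrt_integral_sq (μ : Measure Ω) [IsProbabilityMeasure μ] {g : Ω → ℝ}
    (hg : MemLp g 2 μ) : ∫ x, |g x| ∂μ ≤ Real.sqrt (∫ x, g x ^ 2 ∂μ) := by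
  set c := ∫ x, |g x| ∂μ with hc
  have hgi : Integrable g μ := hg.integrable one_le_two
  have hai : Integrable (fun x => |g x|) μ := hgi.abs
  have hsq : Integrable (fun x => g x ^ 2) μ := hg.integrable_sq
  have h0 : 0 ≤ ∫ x, (|g x| - c) ^ 2 ∂μ := integral_nonneg fun x => sq_nonneg _
  have hexp : ∫ x, (|g x| - c) ^ 2 ∂μ = (∫ x, g x ^ 2 ∂μ) - c ^ 2 := by
    have e : (fun x => (|g x| - c) ^ 2) = fun x => (g x ^ 2 - 2 * c * |g x|) + c ^ 2 := by
      funext x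
      rw [sub_sq, sq_abs]
      ring
    rw [e]
    have h1 : ∫ x, (g x ^ 2 - 2 * c * |g x| + c ^ 2) ∂μ = (∫ x, (g x ^ 2 - 2 * c * |g x|) ∂μ) + ∫ _x, c ^ 2 ∂μ :=
      integral_add (hsq.sub (hai.const_mul _)) (integrable_const _)
    have h2 : ∫ x, (g x ^ 2 - 2 * c * |g x|) ∂μ = (∫ x, g x ^ 2 ∂μ) - ∫ x, 2 * c * |g x| ∂μ :=
      integral_sub hsq (hai.const_mul _)
    rw [h1, h2, integral_const_mul, integral_const]
    simp only [probReal_univ, smul_eq_mul, one_mul]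
    rw [← hc]
    ring
  have hc0 : 0 ≤ c := integral_nonneg fun x => abs_nonneg _
  have hle : c ^ 2 ≤ ∫ x, g x ^ 2 ∂μ := by linarith
  calc c = Real.sqrt (c ^ 2) := (Real.sqrt_sq hc0).symm
    _ ≤ Real.sqrt (∫ x, g x ^ 2 ∂μ) := Real.sqrt_le_sqrt hle

/-- The sup distance on `Fin d → ℝ` is bounded by the `ℓ¹` distance. -/
theorem dist_pi_le_sum_abs {d : ℕ} (v w : Fin d → ℝ) : dist v w ≤ ∑ i, |v i - w i| := by
  refine (dist_pi_le_iff (Finset.sum_nonneg fun i _ => abs_nonneg _)).2 fun i => ?_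
  rw [Real.dist_eq]
  exact Finset.single_le_sum (fun j _ => abs_nonneg (v j - w j)) (Finset.mem_univ i)

/-- A bounded Lipschitz function of a measurable vector is integrable (finite measure). -/
theorem integrable_lipschitz_comp (μ : Measure Ω) [IsFiniteMeasure μ] {d : ℕ} {V : Ω → (Fin d → ℝ)}
    (hV : Measurable V) {f : (Fin d → ℝ) → ℝ} (hf : LipschitzWith 1 f) {B : ℝ} (hB : ∀ v, |f v| ≤ B) :
    Integrable (fun ω => f (V ω)) μ :=
  Integrable.of_bound (hf.continuous.measurable.comp hV).aestronglyMeasurable B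
    (ae_of_all _ fun ω => by rw [Real.norm_eq_abs]; exact hB _)

/-- **Bounded Lipschitz test functions along coordinatewise `L²` convergence.** If every coordinate of
`V k : Ω → ℝᵈ` converges in `L²(P)` to the corresponding coordinate of `V∞`, then
`∫ f (V k) dP → ∫ f (V∞) dP` for every bounded `1`-Lipschitz `f`. -/
theorem tendsto_integral_lipschitz_of_l2 (P : Measure Ω) [IsProbabilityMeasure P] {d : ℕ}
    (V : ℕ → Ω → (Fin d → ℝ)) (Vinf : Ω → (Fin d → ℝ)) (hV : ∀ k, Measurable (V k)) (hVinf : Measurable Vinf)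
    (h2 : ∀ k i, MemLp (fun ω => V k ω i) 2 P) (h2inf : ∀ i, MemLp (fun ω => Vinf ω i) 2 P)
    (hlim : ∀ i, Tendsto (fun k => ∫ ω, (V k ω i - Vinf ω i) ^ 2 ∂P) atTop (𝓝 0))
    {f : (Fin d → ℝ) → ℝ} (hf : LipschitzWith 1 f) (hfb : ∃ B, ∀ v, |f v| ≤ B) :
    Tendsto (fun k => ∫ ω, f (V k ω) ∂P) atTop (𝓝 (∫ ω, f (Vinf ω) ∂P)) := by
  obtain ⟨B, hB⟩ := hfb
  -- the error bound `e k = Σᵢ √∫ (V k i − V∞ i)²` tends to `0`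
  set e : ℕ → ℝ := fun k => ∑ i, Real.sqrt (∫ ω, (V k ω i - Vinf ω i) ^ 2 ∂P) with he
  have he0 : Tendsto e atTop (𝓝 0) := by
    have : Tendsto e atTop (𝓝 (∑ _i : Fin d, Real.sqrt 0)) :=
      tendsto_finsetSum _ fun i _ => (hlim i).sqrt
    simpa using this
  rw [tendsto_iff_norm_sub_tendsto_zero]
  refine squeeze_zero (fun k => norm_nonneg _) (fun k => ?_) he0
  -- `|∫ f(V k) − ∫ f(V∞)| ≤ e k`
  have hIk : Integrable (fun ω => f (V k ω)) P := integrable_lipschitz_comp P (hV k) hf hB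
  have hIinf : Integrable (fun ω => f (Vinf ω)) P := integrable_lipschitz_comp P hVinf hf hB
  have hdi : ∀ i, Integrable (fun ω => |V k ω i - Vinf ω i|) P := fun i =>
    (((h2 k i).sub (h2inf i)).integrable one_le_two).abs
  rw [Real.norm_eq_abs, ← integral_sub hIk hIinf]
  calc |∫ ω, (f (V k ω) - f (Vinf ω)) ∂P| ≤ ∫ ω, |f (V k ω) - f (Vinf ω)| ∂P := abs_integral_le_integral_abs
    _ ≤ ∫ ω, ∑ i, |V k ω i - Vinf ω i| ∂P := by
        refine integral_mono (hIk.sub hIinf).abs (integrable_finsetSum _ fun i _ => hdi i) fun ω => ?_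
        calc |f (V k ω) - f (Vinf ω)| = dist (f (V k ω)) (f (Vinf ω)) := (Real.dist_eq _ _).symm
          _ ≤ dist (V k ω) (Vinf ω) := by simpa using hf.dist_le_mul (V k ω) (Vinf ω)
          _ ≤ ∑ i, |V k ω i - Vinf ω i| := dist_pi_le_sum_abs _ _
    _ = ∑ i, ∫ ω, |V k ω i - Vinf ω i| ∂P := integral_finsetSum _ fun i _ => hdi i
    _ ≤ e k := Finset.sum_le_sum fun i _ =>
        integral_abs_le_sqrt_integral_sq P (g := fun ω => V k ω i - Vinf ω i) ((h2 k i).sub (h2inf i))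

/-- The law of coordinate `k` of a path measure from the law of the pair `(k, k+1)`. -/
theorem map_eval_of_map_pair {S : Type*} [MeasurableSpace S] (T : Measure (ℕ → S)) (Pk : Measure (S × S)) (k : ℕ)
    (h : T.map (fun x => (x k, x (k + 1))) = Pk) : T.map (fun x => x k) = Pk.fst := by
  rw [← h]
  exact (Measure.fst_map_prodMk (Y := fun x : ℕ → S => x (k + 1)) (measurable_pi_apply (k + 1))).symm

end General

/-! ### Registered specialisation -/

open Literature.Probability.LatticeModels

/-- **Registered sub-goal `stub_lipschitzTestConvergence`** (tool of `stub_qualitativeOfFDDIsotropy`): bounded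
`1`-Lipschitz test functions pass to the limit along coordinatewise `L²` convergence of random vectors on the chain
space `ℕ → SpinConfig (Site 3)`. -/
theorem stub_lipschitzTestConvergence :
    ∀ (P : Measure (ℕ → SpinConfig (Site 3))) [IsProbabilityMeasure P] (d : ℕ)
      (V : ℕ → (ℕ → SpinConfig (Site 3)) → (Fin d → ℝ)) (Vinf : (ℕ → SpinConfig (Site 3)) → (Fin d → ℝ)),
      (∀ k, Measurable (V k)) → Measurable Vinf → (∀ k i, MemLp (fun ω => V k ω i) 2 P) →
      (∀ i, MemLp (fun ω => Vinf ω i) 2 P) →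
      (∀ i, Tendsto (fun k => ∫ ω, (V k ω i - Vinf ω i) ^ 2 ∂P) atTop (𝓝 0)) →
      ∀ f : (Fin d → ℝ) → ℝ, LipschitzWith 1 f → (∃ B, ∀ v, |f v| ≤ B) →
        Tendsto (fun k => ∫ ω, f (V k ω) ∂P) atTop (𝓝 (∫ ω, f (Vinf ω) ∂P)) :=
  fun P _ _ V Vinf hV hVinf h2 h2inf hlim _ hf hfb =>
    tendsto_integral_lipschitz_of_l2 P V Vinf hV hVinf h2 h2inf hlim hf hfb

end Summit.CriticalPhenomena.Ising3DConformalLimit.Cruxes.RotationJoining.RateSplitting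

end
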